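import Mathlib.NumberTheory.ModularForms.QExpansion
import Mathlib.NumberTheory.ModularForms.Discriminant
import Mathlib.NumberTheory.ModularForms.LevelOne.Basic
import Mathlib.Analysis.Normed.Ring.InfiniteSum

/-!
# `F / Δ ^ m` for a modular form `F` on `Γ₁(M)` — expansions at all cusps

Helper file for `CongruenceToClassical` (route CapacityClassicality, item stmt-Langlands-10367).
For a modular form `F` of weight `k'` on `Γ₁(M)`:

* `eq_tsum_mul_discriminant_pow`: if `qExpansion 1 F = (PowerSeries.mk g) · (qExpansion 1 Δ) ^ m`
  for a sequence `g` whose generating series has radius of convergence `≥ 1`, then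
  `F τ = (∑ g n qⁿ) · Δ τ ^ m` on `ℍ` (Cauchy product);
* `exists_hasSum_slash`: every translate `F ∣[k'] γ`, `γ ∈ SL(2, ℤ)`, has a convergent
  `q_M`-expansion on `ℍ` (it is a modular form on `γ⁻¹ Γ₁(M) γ ⊇ Γ(M)`);
* `slash_div_discriminant_pow_mul`: `((F / Δ ^ m) ∣[k' - 12 m] γ) · Δ ^ m = F ∣[k'] γ`.
-/

set_option linter.dupNamespace false -- project-wide option (lakefile weak.linter.dupNamespace); `Summit.Langlands.Langlands` is the mandated namespace

noncomputable section

open Complex Filter UpperHalfPlane Function ModularForm SlashInvariantFormClass ModularFormClass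
  Matrix.SpecialLinearGroup CongruenceSubgroup

open scoped Real Topology MatrixGroups ModularForm Manifold Pointwise

open Function.Periodic (qParam)

namespace Summit.Langlands.Langlands.Theorems.CapacityClassicality

/-! ## Absolute convergence of the `g`-series -/

/-- A sequence whose generating series is bounded on every circle of radius `< 1` is absolutely
summable against `qⁿ` for `‖q‖ < 1`. -/
theorem summable_norm_mul_pow_of_bound {g : ℕ → ℂ}
    (hrad : ∀ t : ℝ, 0 < t → t < 1 → ∃ C : ℝ, ∀ n, ‖g n‖ * t ^ n ≤ C) {q : ℂ} (hq : ‖q‖ < 1) :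
    Summable fun n ↦ ‖g n * q ^ n‖ := by
  set t : ℝ := (‖q‖ + 1) / 2 with ht
  have ht0 : 0 < t := by positivity
  have ht1 : t < 1 := by rw [ht]; linarith
  have hqt : ‖q‖ < t := by rw [ht]; linarith
  obtain ⟨C, hC⟩ := hrad t ht0 ht1
  have hC0 : 0 ≤ C := le_trans (by positivity) (hC 0)
  have hr : ‖q‖ / t < 1 := (div_lt_one ht0).mpr hqt
  have hr0 : 0 ≤ ‖q‖ / t := by positivity
  refine Summable.of_nonneg_of_le (fun n ↦ norm_nonneg _) (fun n ↦ ?_)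
    ((summable_geometric_of_lt_one hr0 hr).mul_left C)
  rw [norm_mul, norm_pow]
  have : ‖q‖ ^ n = t ^ n * (‖q‖ / t) ^ n := by
    rw [← mul_pow, mul_div_cancel₀ _ ht0.ne']
  rw [this, ← mul_assoc]
  exact mul_le_mul_of_nonneg_right (hC n) (pow_nonneg hr0 n)

/-! ## The identity `F = (∑ g n qⁿ) · Δ ^ m` -/

section

variable {Γ : Subgroup (GL (Fin 2) ℝ)} {k' : ℤ}

/-- The `q`-expansion of a modular form converges absolutely on `ℍ`. -/
theorem summable_norm_qExpansion_coeff_mul_pow [Γ.IsArithmetic] (h1 : (1 : ℝ) ∈ Γ.strictPeriods)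
    (f : ModularForm Γ k') (τ : ℍ) :
    Summable fun n ↦ ‖(qExpansion 1 f).coeff n * qParam 1 τ ^ n‖ := by
  have hrad := qExpansionFormalMultilinearSeries_radius (f := f) one_pos
    (periodic_comp_ofComplex f h1) (holo f) (bdd_at_infty f)
  have hq : ‖qParam (1 : ℝ) (τ : ℂ)‖ < 1 := Periodic.norm_qParam_lt_one one_pos τ.im_pos
  have hr : ((‖qParam (1 : ℝ) (τ : ℂ)‖₊ : ENNReal)) < (qExpansionFormalMultilinearSeries 1 f).radius :=
    lt_of_lt_of_le (by exact_mod_cast hq) hrad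
  have := (qExpansionFormalMultilinearSeries 1 f).summable_norm_mul_pow hr
  refine this.congr fun n ↦ ?_
  rw [qExpansionFormalMultilinearSeries_apply_norm, norm_mul, norm_pow, coe_nnnorm]

/-- `Δ ^ m` as a modular form of level one (`(modularForm Δ).pow m`), as a function. -/
@[simp] lemma coe_discriminant_pow (m : ℕ) :
    ((ModularFormClass.modularForm CuspForm.discriminant).pow m : ℍ → ℂ) =
      fun τ ↦ ModularForm.discriminant τ ^ m := by
  ext τ
  simp

/-- The `q`-expansion of `Δ ^ m` is the `m`-th power of that of `Δ`. -/
lemma qExpansion_discriminant_pow (m : ℕ) :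
    qExpansion 1 ((ModularFormClass.modularForm CuspForm.discriminant).pow m) =
      (qExpansion 1 ModularForm.discriminant) ^ m := by
  rw [ModularForm.qExpansion_pow one_pos one_mem_strictPeriods_SL]
  rfl

/-- **Cauchy product.** If `qExpansion 1 F = (mk g) · (qExpansion 1 Δ) ^ m` with `g` of radius
`≥ 1`, then `F = (∑ g n qⁿ) · Δ ^ m` on `ℍ`. -/
theorem eq_tsum_mul_discriminant_pow [Γ.IsArithmetic] (h1 : (1 : ℝ) ∈ Γ.strictPeriods)
    (F : ModularForm Γ k') (m : ℕ) {g : ℕ → ℂ}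
    (hrad : ∀ t : ℝ, 0 < t → t < 1 → ∃ C : ℝ, ∀ n, ‖g n‖ * t ^ n ≤ C)
    (hF : qExpansion 1 F = PowerSeries.mk g * (qExpansion 1 ModularForm.discriminant) ^ m)
    (τ : ℍ) :
    F τ = (∑' n, g n * qParam 1 τ ^ n) * ModularForm.discriminant τ ^ m := by
  set q : ℂ := qParam 1 (τ : ℂ) with hq_def
  set Dm : ModularForm 𝒮ℒ (m * 12) := (ModularFormClass.modularForm CuspForm.discriminant).pow m
    with hDm
  have hq : ‖q‖ < 1 := Periodic.norm_qParam_lt_one one_pos τ.im_pos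
  -- the three convergent expansions
  have hFsum : HasSum (fun n ↦ (qExpansion 1 F).coeff n * q ^ n) (F τ) := by
    simpa [smul_eq_mul] using hasSum_qExpansion one_pos (periodic_comp_ofComplex F h1) (holo F)
      (bdd_at_infty F) τ
  have hDsum : HasSum (fun n ↦ (qExpansion 1 Dm).coeff n * q ^ n)
      (ModularForm.discriminant τ ^ m) := by
    have := hasSum_qExpansion one_pos (periodic_comp_ofComplex Dm one_mem_strictPeriods_SL)
      (holo Dm) (bdd_at_infty Dm) τ
    simpa [hDm, smul_eq_mul] using this
  have hgabs : Summable fun n ↦ ‖g n * q ^ n‖ := summable_norm_mul_pow_of_bound hrad hq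
  have hDabs : Summable fun n ↦ ‖(qExpansion 1 Dm).coeff n * q ^ n‖ :=
    summable_norm_qExpansion_coeff_mul_pow one_mem_strictPeriods_SL Dm τ
  -- Cauchy product
  have hcauchy := tsum_mul_tsum_eq_tsum_sum_antidiagonal_of_summable_norm hgabs hDabs
  rw [hDsum.tsum_eq] at hcauchy
  rw [hcauchy, ← hFsum.tsum_eq]
  refine tsum_congr fun n ↦ ?_
  rw [hF, hDm, qExpansion_discriminant_pow, PowerSeries.coeff_mul, Finset.sum_mul]
  refine Finset.sum_congr rfl fun ij hij ↦ ?_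
  rw [Finset.HasAntidiagonal.mem_antidiagonal] at hij
  rw [PowerSeries.coeff_mk, ← hij, pow_add]
  ring

end

/-! ## Expansions of the translates `F ∣ γ` -/

section

variable {M : ℕ} {k' : ℤ}

/-- `Γ(M) ≤ Γ₁(M)`. -/
lemma Gamma_le_Gamma1 : CongruenceSubgroup.Gamma M ≤ Gamma1 M := by
  intro A hA
  rw [CongruenceSubgroup.Gamma_mem] at hA
  rw [Gamma1_mem]
  exact ⟨hA.1, hA.2.2.2, hA.2.2.1⟩

/-- The image of `T ^ t` in `GL(2, ℝ)` is the unipotent matrix `[[1, t], [0, 1]]`. -/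
lemma coe_T_zpow_eq_upperRightHom (t : ℤ) :
    mapGL ℝ (ModularGroup.T ^ t : SL(2, ℤ)) =
      Matrix.GeneralLinearGroup.upperRightHom (t : ℝ) := by
  have h1 : ((ModularGroup.T ^ t : SL(2, ℤ)) : Matrix (Fin 2) (Fin 2) ℤ) = !![1, t; 0, 1] :=
    ModularGroup.coe_T_zpow t
  ext i j
  simp only [mapGL_coe_matrix, map_apply_coe, RingHom.mapMatrix_apply, Matrix.map_apply]
  rw [h1]
  fin_cases i <;> fin_cases j <;> simp

/-- `M` is a strict period of `γ⁻¹ Γ₁(M) γ` for every `γ ∈ SL(2, ℤ)`. -/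
lemma natCast_mem_strictPeriods_conj (γ : SL(2, ℤ)) :
    (M : ℝ) ∈ (ConjAct.toConjAct (γ : GL (Fin 2) ℝ)⁻¹ •
      (Gamma1 M : Subgroup (GL (Fin 2) ℝ))).strictPeriods := by
  rw [Subgroup.mem_strictPeriods_iff, Subgroup.mem_pointwise_smul_iff_inv_smul_mem, ← map_inv,
    inv_inv, ConjAct.toConjAct_smul]
  have hT : ModularGroup.T ^ (M : ℤ) ∈ CongruenceSubgroup.Gamma M := by
    simpa using CongruenceSubgroup.ModularGroup_T_pow_mem_Gamma (M : ℤ) (M : ℤ) dvd_rfl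
  have hconj : γ * ModularGroup.T ^ (M : ℤ) * γ⁻¹ ∈ Gamma1 M :=
    Gamma_le_Gamma1 ((CongruenceSubgroup.Gamma_normal M).conj_mem _ hT γ)
  refine ⟨γ * ModularGroup.T ^ (M : ℤ) * γ⁻¹, hconj, ?_⟩
  rw [map_mul, map_mul, map_inv]
  congr 2
  have := coe_T_zpow_eq_upperRightHom (M : ℤ)
  simpa using this

/-- Every translate `F ∣[k'] γ` of a modular form on `Γ₁(M)` has a convergent `q_M`-expansion
on `ℍ`. -/
theorem exists_hasSum_slash [NeZero M] (F : ModularForm (Gamma1 M) k') (γ : SL(2, ℤ)) :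
    ∃ b : ℕ → ℂ, ∀ τ : ℍ, HasSum (fun n ↦ b n * qParam M τ ^ n) (((F : ℍ → ℂ) ∣[k'] γ) τ) := by
  have hM : (0 : ℝ) < M := by exact_mod_cast Nat.pos_of_ne_zero (NeZero.ne M)
  let Fγ := ModularForm.translate F (γ : GL (Fin 2) ℝ)
  have hper : Periodic (((F : ℍ → ℂ) ∣[k'] γ) ∘ ofComplex) M :=
    periodic_comp_ofComplex Fγ (natCast_mem_strictPeriods_conj γ)
  have hbdd : IsBoundedAtImInfty ((F : ℍ → ℂ) ∣[k'] γ) :=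
    ModularFormClass.bdd_at_infty_slash F γ
  have hhol : MDifferentiable 𝓘(ℂ) 𝓘(ℂ) ((F : ℍ → ℂ) ∣[k'] γ) := holo Fγ
  refine ⟨fun n ↦ (qExpansion M ((F : ℍ → ℂ) ∣[k'] γ)).coeff n, fun τ ↦ ?_⟩
  have := hasSum_qExpansion hM hper hhol hbdd τ
  simpa [smul_eq_mul] using this

/-- The quotient `F / Δ ^ m` slashed at `γ ∈ SL(2, ℤ)`:
`((F / Δ^m) ∣[k' - 12 m] γ) · Δ^m = F ∣ γ`. -/
theorem slash_div_discriminant_pow_mul (F : ModularForm (Gamma1 M) k') (m : ℕ) (k : ℤ)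
    (hk : k = k' - m * 12) (γ : SL(2, ℤ)) (τ : ℍ) :
    ((fun τ ↦ F τ / ModularForm.discriminant τ ^ m) ∣[k] γ) τ * ModularForm.discriminant τ ^ m =
      ((F : ℍ → ℂ) ∣[k'] γ) τ := by
  have hΔ : ((ModularForm.discriminant ^ m : ℍ → ℂ)) ∣[(m * 12 : ℤ)] γ =
      (ModularForm.discriminant ^ m : ℍ → ℂ) := by
    have := SlashInvariantForm.slash_action_eqn
      ((ModularFormClass.modularForm CuspForm.discriminant).pow m) (γ : GL (Fin 2) ℝ) ⟨γ, rfl⟩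
    simpa [SL_slash] using this
  have hdiv := ModularForm.div_slash_SL2 k' (m * 12) γ (F : ℍ → ℂ)
    (ModularForm.discriminant ^ m : ℍ → ℂ)
  rw [← hk, hΔ] at hdiv
  have hfun : (fun τ ↦ F τ / ModularForm.discriminant τ ^ m) =
      (F : ℍ → ℂ) / (ModularForm.discriminant ^ m : ℍ → ℂ) := rfl
  rw [hfun, hdiv, Pi.div_apply, Pi.pow_apply,
    div_mul_cancel₀ _ (pow_ne_zero _ (ModularForm.discriminant_ne_zero τ))]

/-- The quotient `F / Δ ^ m` slashed at `γ ∈ Γ₁(M)` is itself. -/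
theorem slash_div_discriminant_pow_of_mem (F : ModularForm (Gamma1 M) k') (m : ℕ) (k : ℤ)
    (hk : k = k' - m * 12) {γ : SL(2, ℤ)} (hγ : γ ∈ Gamma1 M) :
    (fun τ ↦ F τ / ModularForm.discriminant τ ^ m) ∣[k] γ =
      fun τ ↦ F τ / ModularForm.discriminant τ ^ m := by
  funext τ
  have h := slash_div_discriminant_pow_mul F m k hk γ τ
  have hF : ((F : ℍ → ℂ) ∣[k'] γ) = F :=
    SlashInvariantForm.slash_action_eqn F (γ : GL (Fin 2) ℝ) ⟨γ, hγ, rfl⟩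
  rw [hF] at h
  exact (eq_div_iff (pow_ne_zero _ (ModularForm.discriminant_ne_zero τ))).mpr h

/-- The quotient `F / Δ ^ m` is holomorphic on `ℍ`. -/
theorem mdifferentiable_div_discriminant_pow (F : ModularForm (Gamma1 M) k') (m : ℕ) :
    MDifferentiable 𝓘(ℂ) 𝓘(ℂ) (fun τ : ℍ ↦ F τ / ModularForm.discriminant τ ^ m) := by
  have hF := UpperHalfPlane.mdifferentiable_iff.mp (holo F)
  set Dm : ModularForm 𝒮ℒ (m * 12) := (ModularFormClass.modularForm CuspForm.discriminant).pow m
    with hDm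
  have hD := UpperHalfPlane.mdifferentiable_iff.mp (holo Dm)
  rw [UpperHalfPlane.mdifferentiable_iff]
  have : (fun τ : ℍ ↦ F τ / ModularForm.discriminant τ ^ m) ∘ ofComplex =
      fun z ↦ ((F : ℍ → ℂ) ∘ ofComplex) z / ((Dm : ℍ → ℂ) ∘ ofComplex) z := by
    funext z; simp [hDm]
  rw [this]
  exact hF.div hD fun z _ ↦ by
    simpa [hDm] using pow_ne_zero m (ModularForm.discriminant_ne_zero (ofComplex z))

end

end Summit.Langlands.Langlands.Theorems.CapacityClassicality
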